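import Mathlib
import Summits.Ventures.PercRepro2.CoinChainXASixTopGate
import Summits.Ventures.PercRepro2.CoinChainXAClosedGateSums

/-!
# The `GM` fact: the `j`-marked surviving clusters are `y`-richer than the whole chain law
(blind cell PercRepro2, night-2 g32; proofs/NIGHT2-DARC.md §73.7d)

`cg_fact_GM`: for `ent = {m}` and the markers vanishing on the ideal, with `μ = ν·(c off the `m`-clusters, d on them)`
the chain's world-0 law, `(XU + XM)·Py ≤ L·(XYU + XYM)`: one application of the set-level four functions theorem
`ad_sets_dec` over the WHOLE lattice with `L₁ = νd·x`, `L₂ = μ·y`, `L₃ = μ`, `L₄ = νd·xy` — the pointwise law inequality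
`d(s)·μ(t) ≤ μ(s ∩ t)·d(s ∪ t)` holds in all four cases of `m ∈ s`, `m ∈ t` by `hdd`, `hdc`, `hcd`.  It is the fact that
turns the `j` gate into the mj gate minus `L·(L − Px)·(L·XYM − Py·XM)`: `T_j = T_mj + L(L − Px)(L·XYU − Py·XU) ≥ T_j⁻`.
-/

namespace Summit.Ventures.PercRepro2.Coin

open Classical

section GMFact

variable {V : Type*} [DecidableEq V] {R : Type*} [Field R] [LinearOrder R] [IsStrictOrderedRing R]

/-- The pointwise law inequality of the `GM` fact: `d(s)·μ(t) ≤ μ(s ∩ t)·d(s ∪ t)` for the piecewise law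
`μ = (d on the m-clusters, c elsewhere)`. -/
theorem gm_law_pw (m : V) (c d : Finset V → R) (hd0 : ∀ W, 0 ≤ d W) (hdc : ∀ W, d W ≤ c W)
    (hcd : ∀ s t, c s * d t ≤ c (s ∩ t) * d (s ∪ t)) (hdd : ∀ s t, d s * d t ≤ d (s ∩ t) * d (s ∪ t)) (s t : Finset V) :
    d s * (if ∃ r ∈ ({m} : Finset V), r ∈ t then d t else c t) ≤
      (if ∃ r ∈ ({m} : Finset V), r ∈ s ∩ t then d (s ∩ t) else c (s ∩ t)) * d (s ∪ t) := by
  by_cases hs : m ∈ s <;> by_cases ht : m ∈ t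
  · have h1 : ∃ r ∈ ({m} : Finset V), r ∈ t := ⟨m, Finset.mem_singleton_self m, ht⟩
    have h2 : ∃ r ∈ ({m} : Finset V), r ∈ s ∩ t := ⟨m, Finset.mem_singleton_self m, Finset.mem_inter.2 ⟨hs, ht⟩⟩
    rw [if_pos h1, if_pos h2]; exact hdd s t
  · have h1 : ¬ ∃ r ∈ ({m} : Finset V), r ∈ t := fun ⟨r, hr, hrt⟩ => ht (Finset.mem_singleton.1 hr ▸ hrt)
    have h2 : ¬ ∃ r ∈ ({m} : Finset V), r ∈ s ∩ t := fun ⟨r, hr, hrt⟩ => ht (Finset.mem_singleton.1 hr ▸ (Finset.mem_inter.1 hrt).2)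
    rw [if_neg h1, if_neg h2]
    calc d s * c t = c t * d s := by ring
      _ ≤ c (t ∩ s) * d (t ∪ s) := hcd t s
      _ = c (s ∩ t) * d (s ∪ t) := by rw [Finset.inter_comm, Finset.union_comm]
  · have h1 : ∃ r ∈ ({m} : Finset V), r ∈ t := ⟨m, Finset.mem_singleton_self m, ht⟩
    have h2 : ¬ ∃ r ∈ ({m} : Finset V), r ∈ s ∩ t := fun ⟨r, hr, hrt⟩ => hs (Finset.mem_singleton.1 hr ▸ (Finset.mem_inter.1 hrt).1)
    rw [if_pos h1, if_neg h2]
    calc d s * d t ≤ d (s ∩ t) * d (s ∪ t) := hdd s t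
      _ ≤ c (s ∩ t) * d (s ∪ t) := mul_le_mul_of_nonneg_right (hdc _) (hd0 _)
  · have h1 : ¬ ∃ r ∈ ({m} : Finset V), r ∈ t := fun ⟨r, hr, hrt⟩ => ht (Finset.mem_singleton.1 hr ▸ hrt)
    have h2 : ¬ ∃ r ∈ ({m} : Finset V), r ∈ s ∩ t := fun ⟨r, hr, hrt⟩ => ht (Finset.mem_singleton.1 hr ▸ (Finset.mem_inter.1 hrt).2)
    rw [if_neg h1, if_neg h2]
    calc d s * c t = c t * d s := by ring
      _ ≤ c (t ∩ s) * d (t ∪ s) := hcd t s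
      _ = c (s ∩ t) * d (s ∪ t) := by rw [Finset.inter_comm, Finset.union_comm]

/-- **The `GM` fact** `(XU + XM)·Py ≤ L·(XYU + XYM)`: the `j`-marked surviving clusters (coin-entered and sure-entered)
are `y`-richer than the whole world-0 law. -/
theorem cg_fact_GM (U : Finset V) (m : V) (ent' : Finset V) (ν c d : Finset V → R)
    (hν0 : ∀ W, 0 ≤ ν W) (hν : ∀ s ⊆ U, ∀ t ⊆ U, ν s * ν t ≤ ν (s ∩ t) * ν (s ∪ t))
    (hc0 : ∀ W, 0 ≤ c W) (hd0 : ∀ W, 0 ≤ d W) (hdc : ∀ W, d W ≤ c W)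
    (hcd : ∀ s t, c s * d t ≤ c (s ∩ t) * d (s ∪ t)) (hdd : ∀ s t, d s * d t ≤ d (s ∩ t) * d (s ∪ t))
    (x y : Finset V → R) (hx0 : ∀ W, 0 ≤ x W) (hy0 : ∀ W, 0 ≤ y W)
    (hxm : ∀ s t, x s ≤ x (s ∪ t)) (hym : ∀ s t, y s ≤ y (s ∪ t))
    (hxI : ∀ W, (¬ ∃ r ∈ ({m} : Finset V) ∪ ent', r ∈ W) → x W = 0)
    (hyI : ∀ W, (¬ ∃ r ∈ ({m} : Finset V) ∪ ent', r ∈ W) → y W = 0) :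
    ((∑ W ∈ U.powerset.filter (fun W => (¬ ∃ r ∈ ({m} : Finset V), r ∈ W) ∧ ∃ r ∈ ent', r ∈ W), ν W * d W * x W)
        + (∑ W ∈ U.powerset.filter (fun W => ∃ r ∈ ({m} : Finset V), r ∈ W), ν W * d W * x W))
      * ((∑ W ∈ U.powerset.filter (fun W => (¬ ∃ r ∈ ({m} : Finset V), r ∈ W) ∧ ∃ r ∈ ent', r ∈ W), ν W * (c W - d W) * y W)
        + (∑ W ∈ U.powerset.filter (fun W => (¬ ∃ r ∈ ({m} : Finset V), r ∈ W) ∧ ∃ r ∈ ent', r ∈ W), ν W * d W * y W)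
        + (∑ W ∈ U.powerset.filter (fun W => ∃ r ∈ ({m} : Finset V), r ∈ W), ν W * d W * y W)) ≤
    ((∑ W ∈ U.powerset.filter (fun W => ¬ ∃ r ∈ ({m} : Finset V) ∪ ent', r ∈ W), ν W * c W)
        + (∑ W ∈ U.powerset.filter (fun W => (¬ ∃ r ∈ ({m} : Finset V), r ∈ W) ∧ ∃ r ∈ ent', r ∈ W), ν W * (c W - d W))
        + (∑ W ∈ U.powerset.filter (fun W => (¬ ∃ r ∈ ({m} : Finset V), r ∈ W) ∧ ∃ r ∈ ent', r ∈ W), ν W * d W)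
        + (∑ W ∈ U.powerset.filter (fun W => ∃ r ∈ ({m} : Finset V), r ∈ W), ν W * d W))
      * ((∑ W ∈ U.powerset.filter (fun W => (¬ ∃ r ∈ ({m} : Finset V), r ∈ W) ∧ ∃ r ∈ ent', r ∈ W), ν W * d W * (x W * y W))
        + (∑ W ∈ U.powerset.filter (fun W => ∃ r ∈ ({m} : Finset V), r ∈ W), ν W * d W * (x W * y W))) := by
  set μ : Finset V → R := fun W => if ∃ r ∈ ({m} : Finset V), r ∈ W then d W else c W with hμ
  have hμ0 : ∀ W, 0 ≤ μ W := fun W => by simp only [hμ]; split_ifs <;> [exact hd0 W; exact hc0 W]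
  have key := ad_sets_dec U (fun W => ν W * d W * x W) (fun W => ν W * μ W * y W) (fun W => ν W * μ W)
    (fun W => ν W * d W * (x W * y W))
    (fun W => mul_nonneg (mul_nonneg (hν0 W) (hd0 W)) (hx0 W)) (fun W => mul_nonneg (mul_nonneg (hν0 W) (hμ0 W)) (hy0 W))
    (fun W => mul_nonneg (hν0 W) (hμ0 W)) (fun W => mul_nonneg (mul_nonneg (hν0 W) (hd0 W)) (mul_nonneg (hx0 W) (hy0 W)))
    (fun _ => True) (fun _ => True) (fun _ => True) (fun _ => True) (by
      intro s hs t ht _ _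
      refine ⟨trivial, trivial, ?_⟩
      have hxt : x s ≤ x (s ∪ t) := hxm s t
      have hyt : y t ≤ y (s ∪ t) := by rw [Finset.union_comm]; exact hym t s
      have hlaw : d s * μ t ≤ μ (s ∩ t) * d (s ∪ t) := by
        simp only [hμ]; exact gm_law_pw m c d hd0 hdc hcd hdd s t
      calc ν s * d s * x s * (ν t * μ t * y t) = (ν s * ν t) * (d s * μ t) * (x s * y t) := by ring
        _ ≤ (ν (s ∩ t) * ν (s ∪ t)) * (μ (s ∩ t) * d (s ∪ t)) * (x (s ∪ t) * y (s ∪ t)) :=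
            mul_le_mul (mul_le_mul (hν s hs t ht) hlaw (mul_nonneg (hd0 s) (hμ0 t)) (mul_nonneg (hν0 _) (hν0 _)))
              (mul_le_mul hxt hyt (hy0 t) (hx0 _)) (mul_nonneg (hx0 s) (hy0 t))
              (mul_nonneg (mul_nonneg (hν0 _) (hν0 _)) (mul_nonneg (hμ0 _) (hd0 _)))
        _ = ν (s ∩ t) * μ (s ∩ t) * (ν (s ∪ t) * d (s ∪ t) * (x (s ∪ t) * y (s ∪ t))) := by ring)
  simp only [Finset.filter_true] at key
  rw [sum_three_regions U {m} ent', sum_three_regions U {m} ent' (fun W => ν W * μ W * y W),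
    sum_three_regions U {m} ent' (fun W => ν W * μ W), sum_three_regions U {m} ent' (fun W => ν W * d W * (x W * y W))] at key
  -- the ideal carries no marker
  have hI1 : (∑ W ∈ U.powerset.filter (fun W => ¬ ∃ r ∈ ({m} : Finset V) ∪ ent', r ∈ W), ν W * d W * x W) = 0 :=
    cgate_sum_zero U _ _ (fun W hW => by rw [hxI W hW, mul_zero])
  have hI2 : (∑ W ∈ U.powerset.filter (fun W => ¬ ∃ r ∈ ({m} : Finset V) ∪ ent', r ∈ W), ν W * μ W * y W) = 0 :=
    cgate_sum_zero U _ _ (fun W hW => by rw [hyI W hW, mul_zero])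
  have hI4 : (∑ W ∈ U.powerset.filter (fun W => ¬ ∃ r ∈ ({m} : Finset V) ∪ ent', r ∈ W), ν W * d W * (x W * y W)) = 0 :=
    cgate_sum_zero U _ _ (fun W hW => by rw [hxI W hW, zero_mul, mul_zero])
  -- the piecewise law by region
  have hI3 : (∑ W ∈ U.powerset.filter (fun W => ¬ ∃ r ∈ ({m} : Finset V) ∪ ent', r ∈ W), ν W * μ W)
      = ∑ W ∈ U.powerset.filter (fun W => ¬ ∃ r ∈ ({m} : Finset V) ∪ ent', r ∈ W), ν W * c W :=
    Finset.sum_congr rfl (fun W hW => by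
      have h := (Finset.mem_filter.1 hW).2
      have hm : ¬ ∃ r ∈ ({m} : Finset V), r ∈ W := fun ⟨r, hr, hrW⟩ => h ⟨r, Finset.mem_union.2 (Or.inl hr), hrW⟩
      simp only [hμ, if_neg hm])
  have hD2 : (∑ W ∈ U.powerset.filter (fun W => (¬ ∃ r ∈ ({m} : Finset V), r ∈ W) ∧ ∃ r ∈ ent', r ∈ W), ν W * μ W * y W)
      = ∑ W ∈ U.powerset.filter (fun W => (¬ ∃ r ∈ ({m} : Finset V), r ∈ W) ∧ ∃ r ∈ ent', r ∈ W), ν W * c W * y W :=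
    Finset.sum_congr rfl (fun W hW => by simp only [hμ, if_neg (Finset.mem_filter.1 hW).2.1])
  have hD3 : (∑ W ∈ U.powerset.filter (fun W => (¬ ∃ r ∈ ({m} : Finset V), r ∈ W) ∧ ∃ r ∈ ent', r ∈ W), ν W * μ W)
      = ∑ W ∈ U.powerset.filter (fun W => (¬ ∃ r ∈ ({m} : Finset V), r ∈ W) ∧ ∃ r ∈ ent', r ∈ W), ν W * c W :=
    Finset.sum_congr rfl (fun W hW => by simp only [hμ, if_neg (Finset.mem_filter.1 hW).2.1])
  have hM2 : (∑ W ∈ U.powerset.filter (fun W => ∃ r ∈ ({m} : Finset V), r ∈ W), ν W * μ W * y W)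
      = ∑ W ∈ U.powerset.filter (fun W => ∃ r ∈ ({m} : Finset V), r ∈ W), ν W * d W * y W :=
    Finset.sum_congr rfl (fun W hW => by simp only [hμ, if_pos (Finset.mem_filter.1 hW).2])
  have hM3 : (∑ W ∈ U.powerset.filter (fun W => ∃ r ∈ ({m} : Finset V), r ∈ W), ν W * μ W)
      = ∑ W ∈ U.powerset.filter (fun W => ∃ r ∈ ({m} : Finset V), r ∈ W), ν W * d W :=
    Finset.sum_congr rfl (fun W hW => by simp only [hμ, if_pos (Finset.mem_filter.1 hW).2])
  rw [hI1, hI2, hI3, hI4, hD2, hD3, hM2, hM3, zero_add, zero_add, zero_add,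
    cg_split U ν c d (fun W => (¬ ∃ r ∈ ({m} : Finset V), r ∈ W) ∧ ∃ r ∈ ent', r ∈ W) y,
    cg_split' U ν c d (fun W => (¬ ∃ r ∈ ({m} : Finset V), r ∈ W) ∧ ∃ r ∈ ent', r ∈ W)] at key
  linear_combination key

end GMFact

end Summit.Ventures.PercRepro2.Coin
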